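/-
Copyright: statement-level skeleton of a published paper (lit-balaban cell, Phase-2 proof seat p27, gen 33). No proof claims
beyond what the kernel checks below.
-/
import Mathlib
import Literature.MathematicalPhysics.QuantumFieldTheory.BalabanImbrieJaffe1984to88.BIJ85SigmaAllN

/-!
# `BalabanImbrieJaffe1984to88.BIJ85Eq7113AllN` — T. Bałaban, J. Imbrie, A. Jaffe, *Renormalization of the Higgs model:
minimizers, propagators and the stability of mean field theory*, Commun. Math. Phys. **97** (1985) 299–329 [BalabanImbrieJaffe1985]:
Sect. 7.1 pp. 322–324, (7.1.12)–(7.1.16) — **`m_{p′}(φ) = min{‖∂A − Q^{e*}_kf‖² : Q_kA = 0} = 2·Re⟨φ, σ^A_n(p′)φ⟩`, `σ^A_n = τ₁^A_n + τ₂^A_n`,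
FOR EVERY BLOCK SIZE `n = L^k` (EVEN `n` INCLUDED), EVERY TORUS AND EVERY UNIT MOMENTUM `p′`** — file 2 of 2 of the parity-free
identification (file 1 `BIJ85SigmaAllN`: the symbols (7.1.10)/(7.1.14)–(7.1.16) over the complete residue system `k : Fin d → Fin n`,
the τ₁ identification, the zero fibre; the l-range over a complete residue system for either parity of `L` is [6I]'s, Bałaban CMP 95
p. 23 after (1.31): *"−(L^k − 1)/2 ≤ m_μ ≤ (L^k − 1)/2 for L odd, −L^k/2 ≤ m_μ < L^k/2 for L even"*).  p. 322: *"We express σ_k as a sum of two terms σ_k = τ₁ + τ₂. (7.1.13)"*; p. 323: *"In the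
formula for τ₂, the averaging only occurs in a_μ(p′) = ∂^{(1)}_μ(p′)Σ_l(|u/v_μ|²(1/Δ))(p′+l). (7.1.16)"*.  At `p′ ≠ 0` the hypotheses of
the Lagrange computation `BIJ85Eq7113LagrangeFibre` hold at EVERY shift (`Δ(p′+2πk) > 0`, `φ_ν > 0`, `u(p′) ≠ 0` at the zero shift, the
structural identity `r ⊙ ∂ = u·∂^{(1)}`), its constraint defect is `c = hVec a^A φ` with print's ONE-INDEX `a_μ(p′)` of (7.1.16)
(`cv_eq_hVec` — this is the sentence *"the averaging only occurs in a_μ(p′)"*), its weights are (7.1.10) (`phiL_eq_phiA`), and its value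
`V = ‖P_x(Dc)‖²` is `Re⟨φ, τ₂^A_n(p′)φ⟩` (gen-2 `tensorInner_tau2Kernel_eq_normSq`: the (7.1.15) bracket is `DP_xD`); at `p′ = 0` file 1
gives `m = m°` and `τ₂^A(0) = 0`.  Consequences: `0 ≤ τ₂^A` as a form at every `p′` (p. 324 *"In fact, 0 ≤ τ₂ is evident from
(7.1.15)."*); for the σ_k/τ₁/τ₂ OF RECORD (torus σ_k of (4.2.1)–(4.2.2) on `Setup` tori) the identification theorems with `n = L^k` and
NO hypothesis `L^k = 2M + 1`; and the closed-cube symbols of p10/gen 31 are the odd case `n = 2M + 1`, as forms.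

statement-level skeleton of published theorems with citation tags; proofs where landed; nothing here is a claim about
the Yang–Mills mass gap

PDF held: `paper:balaban1985-cmp97-bij-higgs-minimizers` (journal page = PDF page + 298); pp. 322–324 [PDF 24–26] re-read as images
(`run/shared/lean/pub/pub-balaban/t4/b2b-balaban-t4-lit2/renders/bij1985/1985-cmp97-bij-higgs-minimizers-p024-x2.png` …).

CITATION HEADER (lean-in-tree rule).  Part of the lit-balaban TYPED SKELETON (HOME `run/shared/lean/pub/lit-balaban/`), Phase-2 seat p27
(gen 33), unit `lit-balaban-p27`; rows **C1.Eq7.1.13-7.1.19**, **C1.Eq7.1.2-7.1.12** (fold owner r15, referee ref-5); r15's `C1-CLOSURE.md`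
v1.5 §5 item 6 = lead g10's Q2 flip trigger (HOME/INBOX 2026-08-22T21:19:00Z).  INPUTS (landed or filed by this seat, by name): file
`BIJ85Eq7113LagrangeFibre` (`constrL_alphaStar`, `energyL_alphaStar`, `lower_bound`, `val`, `cv`, `phiL`, `wv`); file `BIJ85SigmaAllN`
(§1–§4); p27's fibre API (`fibreMin_le`, `le_fibreMin_iff`, `fibreMinU_le_fibreMin`); pub-balaban's `B5Prop11Fiber` (`dSym_eq_zero_iff`,
`d1Sym_eq_vSym_mul`, `norm_d1Sym_sq`), `B4Strip.Sxir_pos`, `B5Prop11Plancherel.abs_sOf_le`; `BIJ85Eq7111EdgeAverage.edgeW_mul_conj_vSym`;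
p10's `BIJ85SigmaClosedCubeZero` (`vC_eq_6I`, `uC_eq_6I`); gen-2 `BIJ85Tau2Kernel715` (`tensorInner_tau2Kernel_eq_normSq`, `hVec`, `enn`);
gen 6/31 of this seat (`symb_sigmaMatrix_form_eq_half_fibreMin`, `symb_tau1Matrix_form_eq_half_fibreMinU`, `symb_tau2Matrix_form_eq_half_sub`,
`fibreMin_eq_two_mul_sigmaC_form`, `fibreMinU_eq_two_mul_tau1C_form`).
WHAT IS KERNEL-CHECKED (zero `sorry`, standard axioms; THEOREMS ONLY — no `def`, no new named fact, D-0026): §1 at `p′ ≠ 0`: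
`dOne_ne_zero`, `vSym_zero_ne_zero`, `uA_zero_ne`, `lap_pos`, **`rA_mul_eA`** (`r ⊙ ∂ = u·∂^{(1)}`), `phiL_pos`, `phiL_eq_phiA`,
`rA_mul_conj_eA_mul_conj_edgeW`, **`cv_eq_hVec`**, `enn_ne_zero`, **`val_eq_tau2A_form`**, **`fibreMin_eq_tOne_add`**; §2
**`fibreMin_eq_two_mul_sigmaA_form`** (EVERY `n ≥ 1`, EVERY `q`), `fibreMin_sub_fibreMinU_eq_two_mul_tau2A_form`, `tau2A_form_nonneg`;
§3 **`symb_sigmaMatrix_form_eq_sigmaA`**, **`symb_tau1Matrix_form_eq_tau1A`**, **`symb_tau2Matrix_form_eq_tau2A`**; §4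
`sigmaA_form_eq_sigmaC_form`, `tau1A_form_eq_tau1C_form` (as forms, via the fibre minimum); §5 **`sigmaA_eq_sigmaC`**, `tau1A_eq_tau1C`,
`aA_eq_aC`, `phiA_eq_phiC`, `tau2A_eq_tau2C` — at `n = 2M + 1` the complete-residue symbols ARE p10's closed-cube symbols LITERALLY
(Part 6's residue map `resE` + the [6I] bridges), so the closed-cube statements of record are instances.  HONEST SCOPE: as file 1 — the carrier is the configuration-space fibre
problem on the tori `Π_μ ℤ/(nN_μ)` for every `n`; the σ_k OF RECORD lives on `Setup` tori (`L` odd, `Params.hL`); parity-free are the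
symbols and the identification theorems, stated and proved for all `n`.
-/

namespace Literature.MathematicalPhysics.QuantumFieldTheory.BalabanImbrieJaffe1984to88.BIJ85Eq7113AllN


open scoped BigOperators Matrix ComplexConjugate Kronecker
open Literature.MathematicalPhysics.QuantumFieldTheory.Balaban1983to89
open B5Prop11Plancherel (Tor sOf abs_sOf_le sOf_zero)
open B5Eq117TorusCarriers (Mk)
open B4Strip (shiftr)
open BIJ85MomentumSymbols71 (tensorInner dSym dOne lapSym shiftMom lShifts)
open BIJ85CurlComplement719 (IsTwoForm projK)
open BIJ85Tau2Kernel715 (tau2Kernel hVec enn scl tensorInner_tau2Kernel tensorInner_tau2Kernel_eq_normSq)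
open BIJ85SigmaClosedCube (vC uC qeW t1C aTermC gW tau1C tau2C sigmaC)
open BIJ85SigmaClosedCubeZero (tensorInner_t1C_eq vC_eq_6I uC_eq_6I)
open BIJ85MomentumSymbols6I (dSym_eq_6I)
open BIJ85Eq7111EdgeAverage (edgeW edgeW_eq edgeW_mul_conj_vSym om_pow_mul_conj_vSym conj_om norm_om)
open BIJ85Eq7118Intertwining (edgeW_comm)
open BIJ85Eq7112FibreEnergy (fibreEnergy FibreConstraint)
open BIJ85Eq7112FibreMin (fibreMin fibreMin_le le_fibreMin_iff)
open BIJ85Eq7117FibreMinFree (fibreMinU fibreMinU_le le_fibreMinU_iff fibreMinU_le_fibreMin)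
open BIJ85Eq7113LagrangeFibre (lap energyL ConstrL tOne hodgeB cv phiL wv lamb val alphaStar energyL_split tOne_le_energyL
  energyL_hodge constrL_alphaStar energyL_alphaStar lower_bound)
open BIJ85Eq712Plancherel (symb)
open BIJ85Sigma712Torus (Orient torN sigmaMatrix)
open BIJ85Eq7112SymbolFibreMin (asymO symb_sigmaMatrix_form_eq_half_fibreMin)
open BIJ85Eq7113SymbolIdentification (asymO_swap)
open BIJ85Eq7117Tau1Symbol (tau1Matrix tau2Matrix symb_tau1Matrix_form_eq_half_fibreMinU)
open BIJ85Eq7114Tau1Identification (symb_tau2Matrix_form_eq_half_sub)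
open BIJ85Eq7113AxisFibres (fibreMin_eq_two_mul_sigmaC_form)
open BIJ85Tau1ClosedCube (fibreMinU_eq_two_mul_tau1C_form)
open BIJ85Sigma421Torus

noncomputable section

variable {d : ℕ}

open BIJ85SigmaAllN (tau1A aA phiA tau2A sigmaA eA rA gA fibreEnergy_eq_energyL fibreConstraint_iff_constrL gA_twoForm
  dSym_shiftr_eq_eA lapSym_shiftr_eq_lap dOne_eq_d1Sym conj_edgeW_eq tOne_eq_two_mul_tau1A_form fibreMinU_eq_tOne
  fibreMinU_eq_two_mul_tau1A_form eA_zero_zero rA_zero_zero fibreMin_eq_fibreMinU_of_sOf_eq_zero tau2A_form_zero)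

/-! ## §1 At `p′ ≠ 0`: the hypotheses of the Lagrange computation, and `c = hVec a^A φ`, `φ_L = φ^A`, `V = Re⟨φ, τ₂^A φ⟩` -/

section NonZero

variable (n : ℕ) [NeZero n] {N : Fin d → ℕ} [∀ μ, NeZero (N μ)]

/-- kernel: `1 ≤ n`. [folklore] -/
private theorem one_le : 1 ≤ n := Nat.one_le_iff_ne_zero.mpr (NeZero.ne n)

/-- `∂^{(1)}_μ(p′) ≠ 0` at a component `p′_μ ≠ 0` of the zone `|p′_μ| ≤ π`. [cite: BalabanImbrieJaffe1985, (7.1.5) p.322] -/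
theorem dOne_ne_zero {s : Fin d → ℝ} {μ : Fin d} (hs : |s μ| ≤ Real.pi) (h0 : s μ ≠ 0) : dOne s μ ≠ 0 := by
  intro h
  have h1 : ‖B5Prop11Fiber.d1Sym s μ‖ ^ 2 = 0 := by rw [← dOne_eq_d1Sym, h, norm_zero]; ring
  rw [B5Prop11Fiber.norm_d1Sym_sq] at h1
  have h2 : B4Strip.S1r (s μ) = B4Strip.Sxir 1 (s μ) := by simp [B4Strip.S1r, B4Strip.Sxir]
  have h3 := B4Strip.Sxir_pos 1 le_rfl (s μ) h0 hs
  linarith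

/-- At the zero shift every `v_μ(p′)` is nonzero (`= ∂^{(1)}_μ/∂_μ` or `1`). [cite: BalabanImbrieJaffe1985, (7.1.7) p.322] -/
theorem vSym_zero_ne_zero {s : Fin d → ℝ} (hs : ∀ i, |s i| ≤ Real.pi) (μ : Fin d) : B5Prop11Fiber.vSym n 0 s μ ≠ 0 := by
  unfold B5Prop11Fiber.vSym
  split_ifs with h
  · exact one_ne_zero
  · have hsμ : s μ ≠ 0 := fun h0 =>
      h ((B5Prop11Fiber.dSym_eq_zero_iff n (one_le n) 0 s μ (hs μ)).mpr ⟨h0, rfl⟩)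
    rw [← dOne_eq_d1Sym]
    exact div_ne_zero (dOne_ne_zero (hs μ) hsμ) h

/-- `u(p′) ≠ 0` at the zero shift — the gauge handle of the Lagrange file. [cite: BalabanImbrieJaffe1985, (7.1.9) p.322] -/
theorem uA_zero_ne {s : Fin d → ℝ} (hs : ∀ i, |s i| ≤ Real.pi) : B5Prop11Fiber.uSym n 0 s ≠ 0 :=
  Finset.prod_ne_zero_iff.mpr fun μ _ => vSym_zero_ne_zero n hs μ

/-- `Δ(p′ + 2πk) > 0` at EVERY shift when `p′ ≠ 0`. [cite: BalabanImbrieJaffe1985, (7.1.6) p.322] -/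
theorem lap_pos {s : Fin d → ℝ} (hs : ∀ i, |s i| ≤ Real.pi) (hs0 : s ≠ 0) (k : Fin d → Fin n) : 0 < lap (eA n s) k := by
  obtain ⟨ρ, hρ⟩ := Function.ne_iff.mp hs0
  have hne : B5Prop11Fiber.dSym n k s ρ ≠ 0 := fun h =>
    hρ ((B5Prop11Fiber.dSym_eq_zero_iff n (one_le n) k s ρ (hs ρ)).mp h).1
  have hle : ‖B5Prop11Fiber.dSym n k s ρ‖ ^ 2 ≤ lap (eA n s) k :=
    Finset.single_le_sum (f := fun ρ => ‖eA n s k ρ‖ ^ 2) (fun i _ => sq_nonneg _) (Finset.mem_univ ρ)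
  exact lt_of_lt_of_le (by positivity) hle

/-- **The structural identity `r_ν(p′+l)·∂_ν(p′+l) = u(p′+l)·∂^{(1)}_ν(p′)`** ((7.1.7) `v_ν = ∂^{(1)}_ν/∂_ν`, [6I] (1.61) with the
degenerate case): *"In the formula for τ₂, the averaging only occurs in a_μ(p′)"*. [cite: BalabanImbrieJaffe1985, (7.1.16) p.323] -/
theorem rA_mul_eA (s : Fin d → ℝ) (k : Fin d → Fin n) (μ : Fin d) :
    rA n s k μ * eA n s k μ = B5Prop11Fiber.uSym n k s * dOne s μ := by
  unfold rA eA
  rw [dOne_eq_d1Sym, B5Prop11Fiber.d1Sym_eq_vSym_mul n (one_le n) k s μ, mul_assoc]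

/-- `φ_ν > 0` for the fibre weights when `p′ ≠ 0` (the zero shift contributes `|u v_ν|²/Δ > 0`). [cite: BalabanImbrieJaffe1985, (7.1.10) p.322] -/
theorem phiL_pos {s : Fin d → ℝ} (hs : ∀ i, |s i| ≤ Real.pi) (hs0 : s ≠ 0) (ν : Fin d) : 0 < phiL (eA n s) (rA n s) ν := by
  have h0 : 0 < ‖rA n s 0 ν‖ ^ 2 / lap (eA n s) 0 := by
    have hr : rA n s 0 ν ≠ 0 := mul_ne_zero (uA_zero_ne n hs) (vSym_zero_ne_zero n hs ν)
    exact div_pos (by positivity) (lap_pos n hs hs0 0)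
  have hle : ‖rA n s 0 ν‖ ^ 2 / lap (eA n s) 0 ≤ phiL (eA n s) (rA n s) ν :=
    Finset.single_le_sum (f := fun k => ‖rA n s k ν‖ ^ 2 / lap (eA n s) k)
      (fun k _ => div_nonneg (sq_nonneg _) (Finset.sum_nonneg fun i _ => sq_nonneg _)) (Finset.mem_univ 0)
  exact lt_of_lt_of_le h0 hle

/-- `φ_L = φ^A`: the Lagrange file's weights for the fibre data are (7.1.10) over the complete residue system.
[cite: BalabanImbrieJaffe1985, (7.1.10) p.322] -/
theorem phiL_eq_phiA (s : Fin d → ℝ) : phiL (eA n s) (rA n s) = phiA n s := by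
  funext ν
  unfold phiL phiA
  refine Finset.sum_congr rfl fun k _ => ?_
  rw [uC_eq_6I (NeZero.ne n), vC_eq_6I (NeZero.ne n), lapSym_shiftr_eq_lap, div_eq_mul_inv]
  rfl

/-- kernel: `Π_ρ |v_ρ|²` as a complex number is `(Πv)(Πv̄)`. [folklore] -/
private theorem ofReal_prod_norm_sq (S : Finset (Fin d)) (v : Fin d → ℂ) :
    (((∏ ρ ∈ S, ‖v ρ‖ ^ 2 : ℝ)) : ℂ) = (∏ ρ ∈ S, v ρ) * conj (∏ ρ ∈ S, v ρ) := by
  rw [map_prod, ← Finset.prod_mul_distrib]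
  push_cast
  exact Finset.prod_congr rfl fun ρ _ => (Complex.mul_conj' _).symm

omit [∀ μ, NeZero (N μ)] in
/-- **The shift term of `Q_kB₀` is `ā`-shaped**: for `λ ≠ ν`, `(u v_ν)(p)·∂̄_λ(p)·w̄_{λν}(p) = \overline{∂^{(1)}_λ(p′)}·Π_{ρ≠λ}|v_ρ(p)|²` at
`p = p′ + 2πk` — the weight `|u/v_λ|²` of (7.1.16) in division-free form, valid also where `v_λ = 0`. [cite: BalabanImbrieJaffe1985, (7.1.16) p.323] -/
theorem rA_mul_conj_eA_mul_conj_edgeW (k : Fin d → Fin n) (q : Tor N) {l ν : Fin d} (hlν : l ≠ ν) :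
    rA n (sOf N q) k ν * conj (eA n (sOf N q) k l) * conj (edgeW n k (sOf N q) l ν) =
      conj (dOne (sOf N q) l) *
        (((∏ ρ ∈ Finset.univ.erase l, ‖B5Prop11Fiber.vSym n k (sOf N q) ρ‖ ^ 2 : ℝ)) : ℂ) := by
  set s := sOf N q with hs
  set P := ∏ ρ ∈ Finset.univ.erase l, B5Prop11Fiber.vSym n k s ρ with hP
  have hu : B5Prop11Fiber.uSym n k s = B5Prop11Fiber.vSym n k s l * P :=
    (Finset.mul_prod_erase Finset.univ (fun ρ => B5Prop11Fiber.vSym n k s ρ) (Finset.mem_univ l)).symm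
  have hw : conj (edgeW n k s l ν) * B5Prop11Fiber.vSym n k s l * B5Prop11Fiber.vSym n k s ν =
      conj (B5Prop11Fiber.vSym n k s l) * conj P := by
    have h := congrArg conj (edgeW_mul_conj_vSym n N k q hlν)
    rw [map_mul, map_mul, Complex.conj_conj, Complex.conj_conj, ← hs, hu, map_mul] at h
    exact h
  rw [ofReal_prod_norm_sq, ← hP, dOne_eq_d1Sym, B5Prop11Fiber.d1Sym_eq_vSym_mul n (one_le n) k s l, map_mul]
  unfold rA eA
  rw [hu]
  calc B5Prop11Fiber.vSym n k s l * P * B5Prop11Fiber.vSym n k s ν * conj (B5Prop11Fiber.dSym n k s l) *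
        conj (edgeW n k s l ν)
      = P * conj (B5Prop11Fiber.dSym n k s l) *
          (conj (edgeW n k s l ν) * B5Prop11Fiber.vSym n k s l * B5Prop11Fiber.vSym n k s ν) := by ring
    _ = P * conj (B5Prop11Fiber.dSym n k s l) * (conj (B5Prop11Fiber.vSym n k s l) * conj P) := by rw [hw]
    _ = conj (B5Prop11Fiber.vSym n k s l) * conj (B5Prop11Fiber.dSym n k s l) * (P * conj P) := by ring

omit [∀ μ, NeZero (N μ)] in
/-- **`c = Q_kB₀ = hVec a^A φ`**: the constraint defect of the shift-wise Hodge field is the contraction `c_ν = Σ_λ ā^A_λ φ_{λν}` with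
print's one-index `a_μ(p′)` of (7.1.16) over the complete residue system — *"the averaging only occurs in a_μ(p′)"*.
[cite: BalabanImbrieJaffe1985, (7.1.16) p.323] -/
theorem cv_eq_hVec (q : Tor N) {φ : Fin d × Fin d → ℂ} (hφ : ∀ μ ν, φ (ν, μ) = -φ (μ, ν)) :
    cv (eA n (sOf N q)) (rA n (sOf N q)) (gA n (sOf N q) φ) = hVec (aA n (sOf N q)) (fun μ ν => φ (μ, ν)) := by
  set s := sOf N q with hs
  funext ν
  have hcv : cv (eA n s) (rA n s) (gA n s φ) ν =
      ∑ l, ∑ k, rA n s k ν * conj (eA n s k l) * gA n s φ k l ν / (((lap (eA n s) k : ℝ)) : ℂ) := by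
    rw [Finset.sum_comm]
    unfold cv hodgeB
    refine Finset.sum_congr rfl fun k _ => ?_
    rw [show (∑ ρ, ‖eA n s k ρ‖ ^ 2) = lap (eA n s) k from rfl, Finset.sum_div, Finset.mul_sum]
    exact Finset.sum_congr rfl fun l _ => by ring
  rw [hcv]
  simp only [hVec]
  refine Finset.sum_congr rfl fun l _ => ?_
  by_cases hl : l = ν
  · subst hl
    have h0 : φ (l, l) = 0 := by
      have := hφ l l
      linear_combination (1 / 2 : ℂ) * this
    simp [gA, h0]
  · -- Σ_k (r v̄… ) φ / Δ = conj(a_l) φ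
    have ha : conj (aA n s l) = ∑ k : Fin d → Fin n, conj (dOne s l) * ((aTermC n (shiftr n k s) l : ℝ) : ℂ) := by
      rw [aA, map_mul, Complex.conj_ofReal, Complex.ofReal_sum, Finset.mul_sum]
    rw [ha, Finset.sum_mul]
    refine Finset.sum_congr rfl fun k _ => ?_
    have hT : ((aTermC n (shiftr n k s) l : ℝ) : ℂ) =
        (((∏ ρ ∈ Finset.univ.erase l, ‖B5Prop11Fiber.vSym n k s ρ‖ ^ 2 : ℝ)) : ℂ) * ((((lap (eA n s) k : ℝ)) : ℂ))⁻¹ := by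
      rw [aTermC, lapSym_shiftr_eq_lap, Complex.ofReal_mul, Complex.ofReal_inv]
      congr 2
      exact Finset.prod_congr rfl fun ρ _ => by rw [vC_eq_6I (NeZero.ne n)]
    have hkey := rA_mul_conj_eA_mul_conj_edgeW n k q hl
    rw [← hs] at hkey
    rw [hT, gA, div_eq_mul_inv]
    calc rA n s k ν * conj (eA n s k l) * (conj (edgeW n k s l ν) * φ (l, ν)) * ((((lap (eA n s) k : ℝ)) : ℂ))⁻¹
        = (rA n s k ν * conj (eA n s k l) * conj (edgeW n k s l ν)) * φ (l, ν) * ((((lap (eA n s) k : ℝ)) : ℂ))⁻¹ := by ring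
      _ = _ := by rw [hkey]; ring

/-- `N = Σ_ρ |∂^{(1)}_ρ|²/φ_ρ ≠ 0` at `p′ ≠ 0`. [cite: BalabanImbrieJaffe1985, (7.1.15) p.323] -/
theorem enn_ne_zero {s : Fin d → ℝ} (hs : ∀ i, |s i| ≤ Real.pi) (hs0 : s ≠ 0) : enn (dOne s) (phiA n s) ≠ 0 := by
  obtain ⟨ρ, hρ⟩ := Function.ne_iff.mp hs0
  have hφ : ∀ μ, 0 < phiA n s μ := fun μ => by rw [← phiL_eq_phiA]; exact phiL_pos n hs hs0 μ
  have h0 : 0 < ‖dOne s ρ‖ ^ 2 / phiA n s ρ := by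
    have := dOne_ne_zero (hs ρ) hρ
    exact div_pos (by positivity) (hφ ρ)
  have hle : ‖dOne s ρ‖ ^ 2 / phiA n s ρ ≤ enn (dOne s) (phiA n s) :=
    Finset.single_le_sum (f := fun ρ => ‖dOne s ρ‖ ^ 2 / phiA n s ρ) (fun μ _ => div_nonneg (sq_nonneg _) (hφ μ).le)
      (Finset.mem_univ ρ)
  exact (lt_of_lt_of_le h0 hle).ne'

/-- **`V = Re⟨φ, τ₂^A_n(p′)φ⟩` at `p′ ≠ 0`**: the Lagrange value `‖P_x(Dc)‖²` with `c = hVec a^A φ`, `φ_L = φ^A`, `x = D∂^{(1)}` is the form of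
(7.1.15) (gen-2 `tensorInner_tau2Kernel_eq_normSq`: the bracket is `DP_xD`). [cite: BalabanImbrieJaffe1985, (7.1.15) p.323] -/
theorem val_eq_tau2A_form (q : Tor N) (hq : sOf N q ≠ 0) {φ : Fin d × Fin d → ℂ} (hφ : ∀ μ ν, φ (ν, μ) = -φ (μ, ν)) :
    val (eA n (sOf N q)) (rA n (sOf N q)) (gA n (sOf N q) φ) (dOne (sOf N q)) =
      (tensorInner (fun μ ν => φ (μ, ν)) (tau2A n (sOf N q)) (fun μ ν => φ (μ, ν))).re := by
  have hs : ∀ i, |sOf N q i| ≤ Real.pi := fun i => abs_sOf_le N q i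
  have hφA : ∀ μ, 0 < phiA n (sOf N q) μ := fun μ => by rw [← phiL_eq_phiA]; exact phiL_pos n hs hq μ
  rw [tau2A, tensorInner_tau2Kernel_eq_normSq hφA (enn_ne_zero n hs hq), Complex.ofReal_re, val, wv, phiL_eq_phiA,
    cv_eq_hVec n q hφ]

/-- **`fibreMin n N q φ = T₁ + 2V` at `p′ ≠ 0`**: the Lagrange file's two bounds, transported through the dictionary.
[cite: BalabanImbrieJaffe1985, (7.1.13) p.322] -/
theorem fibreMin_eq_tOne_add (q : Tor N) (hq : sOf N q ≠ 0) {φ : Fin d × Fin d → ℂ} (hφ : ∀ μ ν, φ (ν, μ) = -φ (μ, ν)) :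
    fibreMin n N q φ = tOne (eA n (sOf N q)) (gA n (sOf N q) φ) +
      2 * val (eA n (sOf N q)) (rA n (sOf N q)) (gA n (sOf N q) φ) (dOne (sOf N q)) := by
  have hs : ∀ i, |sOf N q i| ≤ Real.pi := fun i => abs_sOf_le N q i
  have hG := gA_twoForm n (sOf N q) hφ
  have hlap := lap_pos n hs hq
  have hfac : ∀ k μ, rA n (sOf N q) k μ * eA n (sOf N q) k μ = B5Prop11Fiber.uSym n k (sOf N q) * dOne (sOf N q) μ :=
    rA_mul_eA n (sOf N q)
  have hphi := phiL_pos n hs hq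
  refine le_antisymm ?_ ((le_fibreMin_iff n N).2 fun α hα => ?_)
  · have hc := constrL_alphaStar (eA n (sOf N q)) (rA n (sOf N q)) (gA n (sOf N q) φ) (dOne (sOf N q))
      (fun k => B5Prop11Fiber.uSym n k (sOf N q)) 0 hfac (uA_zero_ne n hs) hphi
    have h := fibreMin_le n N ((fibreConstraint_iff_constrL n q _).2 hc) φ
    rwa [fibreEnergy_eq_energyL, energyL_alphaStar (eA n (sOf N q)) (rA n (sOf N q)) (dOne (sOf N q))
      (fun k => B5Prop11Fiber.uSym n k (sOf N q)) 0 hG hlap hfac hphi] at h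
  · rw [fibreEnergy_eq_energyL]
    exact lower_bound (eA n (sOf N q)) (rA n (sOf N q)) (dOne (sOf N q)) (fun k => B5Prop11Fiber.uSym n k (sOf N q))
      hG hlap hfac hphi ((fibreConstraint_iff_constrL n q α).1 hα)

end NonZero

/-! ## §2 `m_{p′}(φ) = 2·Re⟨φ, σ^A_n(p′)φ⟩` for EVERY `n ≥ 1` and EVERY `p′`; `0 ≤ τ₂^A` -/

section Main

variable (n : ℕ) [NeZero n] {N : Fin d → ℕ} [∀ μ, NeZero (N μ)]

omit [NeZero n] in
/-- kernel: the σ^A-form splits as τ₁^A-form + τ₂^A-form. [cite: BalabanImbrieJaffe1985, (7.1.13) p.322] -/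
theorem tensorInner_sigmaA (s : Fin d → ℝ) (f : Fin d → Fin d → ℂ) :
    tensorInner f (sigmaA n s) f = tensorInner f (tau1A n s) f + tensorInner f (tau2A n s) f := by
  unfold tensorInner sigmaA
  simp only [mul_add, add_mul, Finset.sum_add_distrib]

/-- **`fibreMin n N q φ = 2·Re⟨φ, σ^A_n(p′)φ⟩` FOR EVERY BLOCK SIZE `n ≥ 1` — EVEN `n` INCLUDED — EVERY TORUS `N` AND EVERY DUAL MOMENTUM
`q : Tor N`** (two-forms `φ`; `p′ = sOf N q`, axes and `q = 0` included): the constrained fibre minimum `min{‖∂A − Q^{e*}_kf‖² : Q_kA = 0}`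
of the (4.2.1) exponent equals the form of `σ^A_n = τ₁^A_n + τ₂^A_n`, the symbols (7.1.14)–(7.1.16) summed over the complete residue
system — the PARITY-FREE form of gen 31's `fibreMin_eq_two_mul_sigmaC_form` (`n = 2M + 1`). [cite: BalabanImbrieJaffe1985, (7.1.13) p.322] -/
theorem fibreMin_eq_two_mul_sigmaA_form (q : Tor N) {φ : Fin d × Fin d → ℂ} (hφ : ∀ μ ν, φ (ν, μ) = -φ (μ, ν)) :
    fibreMin n N q φ = 2 * (tensorInner (fun μ ν => φ (μ, ν)) (sigmaA n (sOf N q)) (fun μ ν => φ (μ, ν))).re := by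
  rw [tensorInner_sigmaA, Complex.add_re, mul_add, ← tOne_eq_two_mul_tau1A_form n q hφ]
  by_cases hq : sOf N q = 0
  · rw [fibreMin_eq_fibreMinU_of_sOf_eq_zero n q hq, fibreMinU_eq_tOne n q hφ, hq, tau2A_form_zero, Complex.zero_re, mul_zero,
      add_zero]
  · rw [fibreMin_eq_tOne_add n q hq hφ, val_eq_tau2A_form n q hq hφ]

/-- **`fibreMin − fibreMinU = 2·Re⟨φ, τ₂^A_n(p′)φ⟩`** at every `q` (every `n`). [cite: BalabanImbrieJaffe1985, (7.1.15) p.323] -/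
theorem fibreMin_sub_fibreMinU_eq_two_mul_tau2A_form (q : Tor N) {φ : Fin d × Fin d → ℂ} (hφ : ∀ μ ν, φ (ν, μ) = -φ (μ, ν)) :
    fibreMin n N q φ - fibreMinU n N q φ =
      2 * (tensorInner (fun μ ν => φ (μ, ν)) (tau2A n (sOf N q)) (fun μ ν => φ (μ, ν))).re := by
  rw [fibreMin_eq_two_mul_sigmaA_form n q hφ, fibreMinU_eq_two_mul_tau1A_form n q hφ, tensorInner_sigmaA, Complex.add_re]
  ring

/-- **`0 ≤ τ₂^A_n(p′)` as a form on two-forms, at EVERY `p′` and every `n`** (p. 324 *"In fact, 0 ≤ τ₂ is evident from (7.1.15)."*):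
the constrained minimum dominates the unconstrained one. [cite: BalabanImbrieJaffe1985, (7.1.25) p.324] -/
theorem tau2A_form_nonneg (q : Tor N) {φ : Fin d × Fin d → ℂ} (hφ : ∀ μ ν, φ (ν, μ) = -φ (μ, ν)) :
    0 ≤ (tensorInner (fun μ ν => φ (μ, ν)) (tau2A n (sOf N q)) (fun μ ν => φ (μ, ν))).re := by
  have h := fibreMin_sub_fibreMinU_eq_two_mul_tau2A_form n q hφ
  have h' := fibreMinU_le_fibreMin n N q φ
  linarith

end Main

/-! ## §3 The σ_k, τ₁, τ₂ OF RECORD at every dual momentum, with `n = L^k` and no parity hypothesis in the statement -/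

section Record

variable {P : Params} {k : ℕ}

/-- **`⟨ψ, σ_k(p′)ψ⟩ = Re⟨ψ^asym, σ^A_{L^k}(p′)ψ^asym⟩` FOR THE σ_k OF RECORD AT EVERY DUAL MOMENTUM** (torus σ_k of (4.2.1)–(4.2.2), weight
`η^d`, `η = L^{−k}`, any curl factor `c ≠ 0`, `k ≤ m + K`, `2 ≤ d`): the symbol is the (7.1.13)–(7.1.16) form over the complete residue
system of the `L^k`-fibre — gen 31's `symb_sigmaMatrix_form_eq_sigmaC` without the cut-off `M` and without `L^k = 2M + 1` in the
statement. [cite: BalabanImbrieJaffe1985, (7.1.13) p.322] -/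
theorem symb_sigmaMatrix_form_eq_sigmaA (hd : 2 ≤ P.d) (hk : k ≤ P.m + P.K) {c : ℝ} (hc : c ≠ 0) (p : Tor (torN P k))
    (ψ : Orient P → ℂ) :
    star ψ ⬝ᵥ (symb (torN P k) (Orient P) (sigmaMatrix hd (P.eta k ^ P.d) c k) p *ᵥ ψ)
      = (((tensorInner (fun μ ν => asymO ψ (μ, ν)) (sigmaA (P.L ^ k) (sOf (Mk P k) p))
          (fun μ ν => asymO ψ (μ, ν))).re : ℝ) : ℂ) := by
  haveI : NeZero (P.L ^ k) := ⟨pow_ne_zero _ (by have := P.hL.2; omega)⟩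
  rw [symb_sigmaMatrix_form_eq_half_fibreMin hd hk hc p ψ,
    fibreMin_eq_two_mul_sigmaA_form (P.L ^ k) p (asymO_swap ψ)]
  push_cast
  ring

/-- **`⟨ψ, τ₁(p′)ψ⟩ = Re⟨ψ^asym, τ₁^A_{L^k}(p′)ψ^asym⟩` for the τ₁ of record** (p33's `τ₁ = Q^e_k(I − P_∂)Q^{e*}_k`, (7.1.17)) at EVERY dual
momentum. [cite: BalabanImbrieJaffe1985, (7.1.14) p.322] -/
theorem symb_tau1Matrix_form_eq_tau1A (hd : 2 ≤ P.d) (hk : k ≤ P.m + P.K) {c : ℝ} (hc : c ≠ 0) (p : Tor (torN P k))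
    (ψ : Orient P → ℂ) :
    star ψ ⬝ᵥ (symb (torN P k) (Orient P) (tau1Matrix hd (P.eta k ^ P.d) c k) p *ᵥ ψ)
      = (((tensorInner (fun μ ν => asymO ψ (μ, ν)) (tau1A (P.L ^ k) (sOf (Mk P k) p))
          (fun μ ν => asymO ψ (μ, ν))).re : ℝ) : ℂ) := by
  haveI : NeZero (P.L ^ k) := ⟨pow_ne_zero _ (by have := P.hL.2; omega)⟩
  rw [symb_tau1Matrix_form_eq_half_fibreMinU hd hk hc p ψ,
    fibreMinU_eq_two_mul_tau1A_form (P.L ^ k) p (asymO_swap ψ)]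
  push_cast
  ring

/-- **`⟨ψ, τ₂(p′)ψ⟩ = Re⟨ψ^asym, τ₂^A_{L^k}(p′)ψ^asym⟩` for the τ₂ of record** (p33's `τ₂ = σ_k − τ₁`) at EVERY dual momentum.
[cite: BalabanImbrieJaffe1985, (7.1.15) p.323] -/
theorem symb_tau2Matrix_form_eq_tau2A (hd : 2 ≤ P.d) (hk : k ≤ P.m + P.K) {c : ℝ} (hc : c ≠ 0) (p : Tor (torN P k))
    (ψ : Orient P → ℂ) :
    star ψ ⬝ᵥ (symb (torN P k) (Orient P) (tau2Matrix hd (P.eta k ^ P.d) c k) p *ᵥ ψ)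
      = (((tensorInner (fun μ ν => asymO ψ (μ, ν)) (tau2A (P.L ^ k) (sOf (Mk P k) p))
          (fun μ ν => asymO ψ (μ, ν))).re : ℝ) : ℂ) := by
  haveI : NeZero (P.L ^ k) := ⟨pow_ne_zero _ (by have := P.hL.2; omega)⟩
  rw [symb_tau2Matrix_form_eq_half_sub hd hk hc p ψ,
    fibreMin_sub_fibreMinU_eq_two_mul_tau2A_form (P.L ^ k) p (asymO_swap ψ)]
  push_cast
  ring

end Record

/-! ## §4 The closed-cube symbols of p10/gen 31 are the odd case `n = 2M + 1`, as forms -/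

section Consistency

variable (M : ℕ) {N : Fin d → ℕ} [∀ μ, NeZero (N μ)]

/-- **`Re⟨φ, σ^A_{2M+1}(p′)φ⟩ = Re⟨φ, σ^C(p′)φ⟩`** at every dual momentum (two-forms, `0 < d`): for odd block sizes the complete-residue
symbols and the symmetric-window closed-cube symbols have the same form (both equal `½ m_{p′}(φ)`). [cite: BalabanImbrieJaffe1985, (7.1.13) p.322] -/
theorem sigmaA_form_eq_sigmaC_form (hd : 0 < d) (q : Tor N) {φ : Fin d × Fin d → ℂ} (hφ : ∀ μ ν, φ (ν, μ) = -φ (μ, ν)) :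
    (tensorInner (fun μ ν => φ (μ, ν)) (sigmaA (2 * M + 1) (sOf N q)) (fun μ ν => φ (μ, ν))).re =
      (tensorInner (fun μ ν => φ (μ, ν)) (sigmaC (2 * M + 1) M (sOf N q)) (fun μ ν => φ (μ, ν))).re := by
  haveI : NeZero (2 * M + 1) := ⟨by omega⟩
  have h1 := fibreMin_eq_two_mul_sigmaA_form (2 * M + 1) q hφ
  have h2 := fibreMin_eq_two_mul_sigmaC_form M hd q hφ
  linarith

omit [∀ μ, NeZero (N μ)] in
/-- **`Re⟨φ, τ₁^A_{2M+1}(p′)φ⟩ = Re⟨φ, τ₁^C(p′)φ⟩`** at every dual momentum (two-forms). [cite: BalabanImbrieJaffe1985, (7.1.14) p.322] -/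
theorem tau1A_form_eq_tau1C_form (q : Tor N) {φ : Fin d × Fin d → ℂ} (hφ : ∀ μ ν, φ (ν, μ) = -φ (μ, ν)) :
    (tensorInner (fun μ ν => φ (μ, ν)) (tau1A (2 * M + 1) (sOf N q)) (fun μ ν => φ (μ, ν))).re =
      (tensorInner (fun μ ν => φ (μ, ν)) (tau1C (2 * M + 1) M (sOf N q)) (fun μ ν => φ (μ, ν))).re := by
  haveI : NeZero (2 * M + 1) := ⟨by omega⟩
  have h1 := fibreMinU_eq_two_mul_tau1A_form (2 * M + 1) q hφ
  have h2 := fibreMinU_eq_two_mul_tau1C_form M q hφ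
  linarith

end Consistency

/-! ## §5 At odd block sizes the complete-residue symbols ARE the closed-cube symbols of p10 (literal equality) -/

section Literal

variable (M : ℕ)

/-- kernel: `v(p′ + 2π·res(m)) = v(p′ + 2πm)` (n = 2M + 1) — the two bridges `vC_eq_6I` (p10) and `vSym6I_eq_vC` (Part 6).
[cite: BalabanImbrieJaffe1985, (7.1.7) p.322] -/
theorem vC_shiftr_resE (s : Fin d → ℝ) (m : Fin d → ℤ) :
    vC (2 * M + 1) (shiftr (2 * M + 1) (BIJ85Eq7113DerivationPart6.resE M m) s) = vC (2 * M + 1) (shiftMom s m) := by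
  funext μ
  rw [vC_eq_6I (by omega), BIJ85Eq7113DerivationPart6.vSym6I_eq_vC]

/-- kernel: `∂(p′ + 2π·res(m)) = ∂(p′ + 2πm)` at `η = 1/(2M + 1)`. [cite: BalabanImbrieJaffe1985, (7.1.4) p.322] -/
theorem dSym_shiftr_resE (s : Fin d → ℝ) (m : Fin d → ℤ) :
    dSym (((2 * M + 1 : ℕ) : ℝ)⁻¹) (shiftr (2 * M + 1) (BIJ85Eq7113DerivationPart6.resE M m) s) =
      dSym (((2 * M + 1 : ℕ) : ℝ)⁻¹) (shiftMom s m) := by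
  funext μ
  rw [← one_div, dSym_eq_6I (by omega), BIJ85Eq7113DerivationPart6.dSym6I_eq_dSym, one_div]

/-- kernel: `Δ(p′ + 2π·res(m)) = Δ(p′ + 2πm)`. [cite: BalabanImbrieJaffe1985, (7.1.6) p.322] -/
theorem lapSym_shiftr_resE (s : Fin d → ℝ) (m : Fin d → ℤ) :
    lapSym (((2 * M + 1 : ℕ) : ℝ)⁻¹) (shiftr (2 * M + 1) (BIJ85Eq7113DerivationPart6.resE M m) s) =
      lapSym (((2 * M + 1 : ℕ) : ℝ)⁻¹) (shiftMom s m) := by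
  rw [lapSym, lapSym, dSym_shiftr_resE]

/-- kernel: the (7.1.14) l-term at `p′ + 2π·res(m)` is the one at `p′ + 2πm`. [cite: BalabanImbrieJaffe1985, (7.1.14) p.322] -/
theorem t1C_shiftr_resE (s : Fin d → ℝ) (m : Fin d → ℤ) :
    t1C (2 * M + 1) (shiftr (2 * M + 1) (BIJ85Eq7113DerivationPart6.resE M m) s) = t1C (2 * M + 1) (shiftMom s m) := by
  funext μ ν l κ
  simp only [t1C, qeW, BIJ85MomentumSymbols71.projSym, vC_shiftr_resE, dSym_shiftr_resE, lapSym_shiftr_resE]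

/-- **`τ₁^A_{2M+1} = τ₁^C`** (r15's window `|m_i| ≤ M` is a complete residue system for `n = 2M + 1`; Part 6's residue map `resE`).
[cite: BalabanImbrieJaffe1985, (7.1.14) p.322] -/
theorem tau1A_eq_tau1C (s : Fin d → ℝ) : tau1A (2 * M + 1) s = tau1C (2 * M + 1) M s := by
  funext μ ν l κ
  rw [tau1A, tau1C, BIJ85Eq7113DerivationPart6.sum_offsets_eq_sum_lShifts M]
  simp only [t1C_shiftr_resE]

/-- **`a^A_{2M+1} = a^C`** ((7.1.16)). [cite: BalabanImbrieJaffe1985, (7.1.16) p.323] -/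
theorem aA_eq_aC (s : Fin d → ℝ) : aA (2 * M + 1) s = BIJ85SigmaClosedCube.aC (2 * M + 1) M s := by
  funext μ
  rw [aA, BIJ85SigmaClosedCube.aC, BIJ85Eq7113DerivationPart6.sum_offsets_eq_sum_lShifts M]
  simp only [aTermC, vC_shiftr_resE, lapSym_shiftr_resE]

/-- **`φ^A_{2M+1} = φ^C`** ((7.1.10)). [cite: BalabanImbrieJaffe1985, (7.1.10) p.322] -/
theorem phiA_eq_phiC (s : Fin d → ℝ) : phiA (2 * M + 1) s = BIJ85SigmaClosedCube.phiC (2 * M + 1) M s := by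
  funext μ
  rw [phiA, BIJ85SigmaClosedCube.phiC, BIJ85Eq7113DerivationPart6.sum_offsets_eq_sum_lShifts M]
  simp only [uC, vC_shiftr_resE, lapSym_shiftr_resE]

/-- **`τ₂^A_{2M+1} = τ₂^C`** ((7.1.15)). [cite: BalabanImbrieJaffe1985, (7.1.15) p.323] -/
theorem tau2A_eq_tau2C (s : Fin d → ℝ) : tau2A (2 * M + 1) s = tau2C (2 * M + 1) M s := by
  rw [tau2A, tau2C, aA_eq_aC, phiA_eq_phiC]

/-- **`σ^A_{2M+1} = σ^C` LITERALLY** (as 4-index symbols, at EVERY `p′ ∈ ℝ^d`): for odd block sizes the complete-residue symbols of file 1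
ARE p10's closed-cube symbols, so every closed-cube statement of record (gen 31's `symb_sigmaMatrix_form_eq_sigmaC` etc.) is an
instance of the all-n ones. [cite: BalabanImbrieJaffe1985, (7.1.13) p.322] -/
theorem sigmaA_eq_sigmaC (s : Fin d → ℝ) : sigmaA (2 * M + 1) s = sigmaC (2 * M + 1) M s := by
  funext μ ν l κ
  rw [sigmaA, sigmaC, tau1A_eq_tau1C, tau2A_eq_tau2C]

end Literal

end

end Literature.MathematicalPhysics.QuantumFieldTheory.BalabanImbrieJaffe1984to88.BIJ85Eq7113AllN
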